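import Summits.BirchSwinnertonDyer.BirchSwinnertonDyer.Theorems.CumulativeHeegnerLeopoldtRedSplitControlAtThreeShaDualAnnihilator
import Literature.NumberTheory.GaloisCohomology.PoitouTateSha
import Literature.AlgebraicTopology.SingularHomology.KroneckerInjectiveSelfInjective
import HarnessLib

/-!
# Poitou–Tate, the annihilator of `Ш¹` — the PERFECT PAIRING `Ш²(K, M) × Ш¹(K, M^D) → ℤ/n` (the conclusion
# of `poitouTate_sha_tateDual` at one module) from a readout of `Ш²` into `Hom(H¹(K, M^D), ℤ/n)` that is
# additive, injective AND SURJECTIVE modulo sums of local pairings (Milne I Thm. 4.10 (a))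

Cell `bsd-wall`, seat `bsd-line-chl-p2` g5 (crux K4 stmt-BirchSwinnertonDyer-24200, stub
`stub_poitouTateShaTateDual` = `poitouTate_sha_tateDual`, item 20462).  Sequel of `…ShaDualCountOfReadout`
(count `#Ш² ≤ #Ш¹` from an additive-and-injective readout): if the readout
`e : Ш²(K, M) → Hom(H¹(K, M^D), ℤ/n)` is moreover SURJECTIVE modulo sums of local pairings (which the
idèle-class route delivers for free, `Ш²(K, M) ≅ coker γ¹` being an isomorphism: `Ext¹(M^D, J̄) → Ext¹(M^D, C̄)
→ Ext²(M^D, K̄ˣ) → Ext²(M^D, J̄)` exact, `α¹` bijective), then `(c, y) ↦ e(c)(y)` on `Ш²(K, M) × Ш¹(K, M^D)`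
is a PERFECT pairing into `ℤ/n` — verbatim the existential conclusion of the named fact
`poitouTate_sha_tateDual K` at `(n, M, ρ)` (`Finite (sha (ρ.tateDual n)) ∧ Finite (shaTwo ρ) ∧ ∃ b, Bijective b
∧ Bijective b.flip`) for a totally complex `K`.

* `exists_addMonoidHom_extend_of_nsmul_eq_zero` — characters `B → ℤ/n` of a subgroup `B` of an `n`-torsion
  abelian group `A` extend to `A` (`ℤ/n` is self-injective: `ZMod.baer_self` + Baer's criterion, through the
  `ℤ/n`-module structures `AddCommGroup.zmodModule`);
* **`sha_tateDual_of_readout`** — the perfect pairing.  Left adjoint: additive (local sums kill `Ш¹`),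
  injective (a readout vanishing on `Ш¹` is a local sum by `exists_family_sum_localTatePairing_eq_of_isTotallyComplex`,
  so `c = 0`), surjective (extend `χ` on `Ш¹` to `φ` on `H¹`, read `φ = e(c) + local sum`); `Ш²` is `n`-torsion
  because it embeds in `Hom(Ш¹, ℤ/n)`; right adjoint by finite duality
  (`AddMonoidHom.bijective_of_injective_of_injective_flip`; characters separate points).

Theorems only; the three readout hypotheses are NOT discharged here (Route A's degree-`2` dictionary); closes no
item; BSD is not proved by any of this.

References: [MilneADT2006] I Thm. 4.10 (a) and proof, §0 Prop. 0.19; [Harari2020] Thm. 17.13 (b); [Lam1999] §15.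
-/

noncomputable section

open Function NumberField IsDedekindDomain
open scoped NumberField

universe u

set_option linter.dupNamespace false
set_option autoImplicit false

namespace Summit.BirchSwinnertonDyer.BirchSwinnertonDyer.Theorems.PoitouTateShaAnnihilator

open Literature.NumberTheory.GaloisRepresentations
open Literature.NumberTheory.GaloisRepresentations.DiscreteGaloisModule (mu localTatePairingZMod tateDual
  unramifiedSubgroup SelmerStructure sha shaTwo)
open Literature.NumberTheory.GaloisCohomology

/-! ## §1 Characters of a subgroup of an `n`-torsion group extend -/

section Extend

/-- **Characters of a subgroup extend** (`ℤ/n` is self-injective, Lam §15; Baer's criterion): for an abelian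
group `A` with `n • A = 0`, a subgroup `B ≤ A` and an additive `χ : B → ℤ/n`, there is an additive `φ : A → ℤ/n`
with `φ|_B = χ`. [cite: Lam1999, §15 and §3B Thm. 3.7] -/
theorem exists_addMonoidHom_extend_of_nsmul_eq_zero {A : Type*} [AddCommGroup A] {n : ℕ} [NeZero n]
    (hA : ∀ a : A, n • a = 0) (B : AddSubgroup A) (χ : B →+ ZMod n) :
    ∃ φ : A →+ ZMod n, ∀ b : B, φ b = χ b := by
  have hB : ∀ b : B, n • b = 0 := fun b => Subtype.ext (by rw [AddSubgroup.coe_nsmul, hA, AddSubgroup.coe_zero])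
  letI : Module (ZMod n) A := AddCommGroup.zmodModule hA
  letI : Module (ZMod n) B := AddCommGroup.zmodModule hB
  obtain ⟨g, hg⟩ := (Literature.AlgebraicTopology.SingularHomology.ZMod.baer_self n).extension_property (B.subtype.toZModLinearMap n)
    (fun x y h => Subtype.ext h) (χ.toZModLinearMap n)
  refine ⟨g.toAddMonoidHom, fun b => ?_⟩
  have := LinearMap.congr_fun hg b
  simpa using this

end Extend

/-! ## §2 The perfect pairing from a readout -/

section Perfect

variable {K : Type u} [Field K] [NumberField K] {M : Type u} [AddCommGroup M] [TopologicalSpace M]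
  [DiscreteTopology M] [Finite M] {n : ℕ} [NeZero n]

/-- **`Ш²(K, M) × Ш¹(K, M^D) → ℤ/n` is perfect, from a readout of `Ш²` that is additive, injective and
surjective modulo sums of local pairings** (Milne I Thm. 4.10 (a) for the module `M`, `K` totally complex;
the three readout properties are what the idèle-class route `Ш²(K, M) ≅ coker γ¹` provides).  Hypotheses:
`inv` with `IsPerfect`, `UnramifiedOrthogonal`, `SelmerComplement`; `M` finite `n`-torsion unramified off the
finite `S₀ ⊇ {v ∣ ∞} ∪ {v ∣ n}`; `Ш¹(K, M^D)` finite; `e : Ш²(K, M) → Hom(H¹(K, M^D), ℤ/n)` with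
(add) `e(c + c') − e(c) − e(c')` a local sum on the classes unramified off some finite `S₁`; (inj) `e(c)` a
local sum against a family vanishing at `∞` and unramified off `S₁ ⊇ S₀` ⟹ `c = 0`; (surj) every additive
`φ : H¹(K, M^D) → ℤ/n` is `e(c) +` a local sum for some `c`.  CONCLUSION: `Ш²(K, M)` is finite and there is a
bi-additive `b : Ш²(K, M) × Ш¹(K, M^D) → ℤ/n` (namely `b(c, y) = e(c)(y)`) both of whose adjoints are
bijective.  [cite: MilneADT2006, Ch. I, Thm. 4.10 (a) and proof, §0 Prop. 0.19] [cite: Harari2020, Thm. 17.13 (b)] -/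
theorem sha_tateDual_of_readout [IsTotallyComplex K]
    {inv : LocalInvariants K n} (hperf : inv.IsPerfect)
    (hur : inv.UnramifiedOrthogonal) (hcomp : inv.SelmerComplement)
    (ρ : DiscreteGaloisModule K M) (hM : ∀ m : M, n • m = 0)
    (S₀ : Finset (Place K)) (hinf : ∀ w : InfinitePlace K, (Sum.inl w : Place K) ∈ S₀)
    (hS₀ : ∀ v : HeightOneSpectrum (𝓞 K), (Sum.inr v : Place K) ∉ S₀ →
      ((n : ℕ) : 𝓞 K) ∉ v.asIdeal ∧ GaloisRep.IsUnramifiedAt v ρ)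
    [Finite (sha (ρ.tateDual n))]
    (e : shaTwo ρ → (galoisCohomology (ρ.tateDual n) 1 →+ ZMod n))
    (hadd : ∀ c c' : shaTwo ρ, ∃ (S₁ : Finset (Place K)) (t : Π v : Place K, galoisCohomology (ρ.toLocal v) 1),
      ∀ (y : galoisCohomology (ρ.tateDual n) 1) (S : Finset (Place K)), S₁ ⊆ S →
        (∀ v : HeightOneSpectrum (𝓞 K), (Sum.inr v : Place K) ∉ S →
          galoisCohomology.localization (ρ.tateDual n) (Sum.inr v) 1 y ∈
            unramifiedSubgroup (GaloisRep.toLocal v (ρ.tateDual n)) 1) →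
        (e (c + c') - e c - e c') y = ∑ v ∈ S, localTatePairingZMod ρ n v (inv v) (t v)
          (galoisCohomology.localization (ρ.tateDual n) v 1 y))
    (hinj : ∀ c : shaTwo ρ, (∃ (S₁ : Finset (Place K)) (t : Π v : Place K, galoisCohomology (ρ.toLocal v) 1),
      S₀ ⊆ S₁ ∧ (∀ w : InfinitePlace K, t (Sum.inl w) = 0) ∧
      (∀ v : HeightOneSpectrum (𝓞 K), (Sum.inr v : Place K) ∉ S₁ →
        t (Sum.inr v) ∈ unramifiedSubgroup (GaloisRep.toLocal v ρ) 1) ∧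
      ∀ (y : galoisCohomology (ρ.tateDual n) 1) (S : Finset (Place K)), S₁ ⊆ S →
        (∀ v : HeightOneSpectrum (𝓞 K), (Sum.inr v : Place K) ∉ S →
          galoisCohomology.localization (ρ.tateDual n) (Sum.inr v) 1 y ∈
            unramifiedSubgroup (GaloisRep.toLocal v (ρ.tateDual n)) 1) →
        e c y = ∑ v ∈ S, localTatePairingZMod ρ n v (inv v) (t v)
          (galoisCohomology.localization (ρ.tateDual n) v 1 y)) → c = 0)
    (hsurj : ∀ φ : galoisCohomology (ρ.tateDual n) 1 →+ ZMod n, ∃ (c : shaTwo ρ) (S₁ : Finset (Place K))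
      (t : Π v : Place K, galoisCohomology (ρ.toLocal v) 1),
      ∀ (y : galoisCohomology (ρ.tateDual n) 1) (S : Finset (Place K)), S₁ ⊆ S →
        (∀ v : HeightOneSpectrum (𝓞 K), (Sum.inr v : Place K) ∉ S →
          galoisCohomology.localization (ρ.tateDual n) (Sum.inr v) 1 y ∈
            unramifiedSubgroup (GaloisRep.toLocal v (ρ.tateDual n)) 1) →
        (φ - e c) y = ∑ v ∈ S, localTatePairingZMod ρ n v (inv v) (t v)
          (galoisCohomology.localization (ρ.tateDual n) v 1 y)) :
    Finite (shaTwo ρ) ∧ ∃ b : shaTwo ρ →+ sha (ρ.tateDual n) →+ ZMod n,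
      (∀ (c : shaTwo ρ) (y : sha (ρ.tateDual n)), b c y = e c y) ∧ Bijective b ∧ Bijective b.flip := by
  classical
  -- local sums vanish on `Ш¹(K, M^D)`
  have hsha_loc : ∀ y : sha (ρ.tateDual n), ∀ v : Place K,
      galoisCohomology.localization (ρ.tateDual n) v 1 (y : galoisCohomology (ρ.tateDual n) 1) = 0 :=
    fun y v => (DiscreteGaloisModule.mem_sha_iff _ _).1 y.2 v
  have hsha_ur : ∀ (y : sha (ρ.tateDual n)) (S : Finset (Place K)),
      ∀ v : HeightOneSpectrum (𝓞 K), (Sum.inr v : Place K) ∉ S →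
        galoisCohomology.localization (ρ.tateDual n) (Sum.inr v) 1 (y : galoisCohomology (ρ.tateDual n) 1) ∈
          unramifiedSubgroup (GaloisRep.toLocal v (ρ.tateDual n)) 1 :=
    fun y S v _ => by rw [hsha_loc y (Sum.inr v)]; exact AddSubgroup.zero_mem _
  have hlocal0 : ∀ (S : Finset (Place K)) (t : Π v : Place K, galoisCohomology (ρ.toLocal v) 1)
      (y : sha (ρ.tateDual n)),
      ∑ v ∈ S, localTatePairingZMod ρ n v (inv v) (t v)
        (galoisCohomology.localization (ρ.tateDual n) v 1 (y : galoisCohomology (ρ.tateDual n) 1)) = 0 :=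
    fun S t y => Finset.sum_eq_zero fun v _ => by rw [hsha_loc y v, map_zero]
  have hshaN : ∀ y : sha (ρ.tateDual n), n • y = 0 := fun y => Subtype.ext (by
    rw [AddSubgroup.coe_nsmul, AddSubgroup.coe_zero]
    exact galoisCohomology.nsmul_eq_zero_of_forall _
      (fun f => DiscreteGaloisModule.TateDual.nsmul_eq_zero f) _)
  -- the pairing `b(c, y) = e(c)(y)`
  have hR_add : ∀ c c' : shaTwo ρ, (e (c + c')).comp (sha (ρ.tateDual n)).subtype =
      (e c).comp (sha (ρ.tateDual n)).subtype + (e c').comp (sha (ρ.tateDual n)).subtype := by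
    intro c c'
    obtain ⟨S₁, t, h⟩ := hadd c c'
    ext y
    have hy := h (y : galoisCohomology (ρ.tateDual n) 1) S₁ le_rfl (hsha_ur y S₁)
    rw [hlocal0] at hy
    simp only [AddMonoidHom.sub_apply] at hy
    simp only [AddMonoidHom.comp_apply, AddSubgroup.coe_subtype, AddMonoidHom.add_apply]
    rw [sub_sub, sub_eq_zero] at hy
    rw [hy]
  let b : shaTwo ρ →+ (sha (ρ.tateDual n) →+ ZMod n) :=
    { toFun := fun c => (e c).comp (sha (ρ.tateDual n)).subtype
      map_zero' := by
        have h := hR_add 0 0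
        rw [add_zero] at h
        exact left_eq_add.1 h
      map_add' := hR_add }
  have hb : ∀ (c : shaTwo ρ) (y : sha (ρ.tateDual n)), b c y = e c y := fun _ _ => rfl
  -- injective: a readout vanishing on `Ш¹` is a local sum (part 3), hence `c = 0` by (inj)
  have hbinj : Injective b := by
    intro c c' hcc'
    rw [← sub_eq_zero]
    apply hinj
    have h0 : b (c - c') = 0 := by rw [map_sub, hcc', sub_self]
    have hφ : ∀ y ∈ sha (ρ.tateDual n), e (c - c') y = 0 := fun y hy => by
      have := DFunLike.congr_fun h0 ⟨y, hy⟩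
      rwa [hb] at this
    exact exists_family_sum_localTatePairing_eq_of_isTotallyComplex hperf hur hcomp ρ hM S₀ hinf hS₀
      (e (c - c')) hφ
  -- surjective: extend a character of `Ш¹` to `H¹(K, M^D)` and read it
  have hbsurj : Surjective b := by
    intro χ
    obtain ⟨φ, hφ⟩ := exists_addMonoidHom_extend_of_nsmul_eq_zero
      (galoisCohomology.nsmul_eq_zero_of_forall _ (fun f => DiscreteGaloisModule.TateDual.nsmul_eq_zero f))
      (sha (ρ.tateDual n)) χ
    obtain ⟨c, S₁, t, h⟩ := hsurj φ
    refine ⟨c, ?_⟩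
    ext y
    have hy := h (y : galoisCohomology (ρ.tateDual n) 1) S₁ le_rfl (hsha_ur y S₁)
    rw [hlocal0, AddMonoidHom.sub_apply, sub_eq_zero] at hy
    rw [hb, ← hy, hφ]
  -- `Ш²` is `n`-torsion (it embeds in `Hom(Ш¹, ℤ/n)`) and finite
  have hshaTwoN : ∀ c : shaTwo ρ, n • c = 0 := fun c => hbinj (by
    rw [map_nsmul, map_zero]
    ext y
    rw [AddMonoidHom.nsmul_apply, AddMonoidHom.zero_apply, nsmul_eq_mul, ZMod.natCast_self, zero_mul])
  haveI : Finite (sha (ρ.tateDual n) →+ ZMod n) := finite_addMonoidHom_zmod _ n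
  haveI hfin : Finite (shaTwo ρ) := Finite.of_injective b hbinj
  -- the right adjoint is injective: characters of `Ш¹` separate points and `b` is onto them
  have hbflip : Injective b.flip := by
    intro y y' hyy'
    by_contra hne
    obtain ⟨χ, hχ⟩ := exists_addMonoidHom_zmod_apply_ne_zero hshaN (sub_ne_zero.2 hne)
    obtain ⟨c, rfl⟩ := hbsurj χ
    apply hχ
    have := DFunLike.congr_fun hyy' c
    rw [AddMonoidHom.flip_apply, AddMonoidHom.flip_apply] at this
    rw [map_sub, this, sub_self]
  exact ⟨hfin, b, hb, AddMonoidHom.bijective_of_injective_of_injective_flip hshaTwoN hshaN b hbinj hbflip⟩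

end Perfect

end Summit.BirchSwinnertonDyer.BirchSwinnertonDyer.Theorems.PoitouTateShaAnnihilator

end
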